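import Literature.MathematicalPhysics.QuantumLattice.GibbsFreeEnergyCouplingConcavity
import Literature.MathematicalPhysics.QuantumLattice.TorusSectorGibbsEnergyWindow
import Literature.MathematicalPhysics.QuantumLattice.PairFieldMomentum
import HarnessLib

/-!
# The free energy of the `t–t'` Hubbard torus is jointly concave in the couplings — grand-canonical
# in `(t, t', U, μ)`, canonical sector in `(t, t', U)`: tangent planes with thermal expectations as
# slopes, Jensen floors, Lipschitz bounds, and thermal double-occupancy / particle-number brackets

Family `hubbard` (topic `MathematicalPhysics/QuantumLattice`); the `t–t'` Hubbard instance of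
`GibbsFreeEnergyCouplingConcavity.lean` (convexity of `H ↦ log tr e^{−βH}`, Peierls–Bogoliubov tangents and
bracket, affine families). Written for the `T > 0` branch of the Hubbard material-oracle programme (stage
S2 (iii), "certificate FAMILIES over parameter BOXES at `T > 0`"; the phase map's `T × (U, t', μ)` cells):
the positive-temperature twin of the ground-state transport calculus
(`HubbardTTPrimeGrandCanonicalEnergyDensity.concaveOn_gcEnergyDensityTT'_couplings`, the `(t', U, μ)`
tangent hyperplane `IsTorusLimitOf.gcEnergyDensityTT'_le_tangent`, the Griffiths brackets of
`HubbardTTPrimeGrandCanonicalBrackets`), here for the FINITE torus `(ℤ/Lℤ)²` at inverse temperature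
`β > 0`, where every quantity is a trace. Notation: `H_L(t,t',U) = hubbardTorusTT' L t t' U`,
`N = totalNumber`, `Z_β(H) = tr e^{−βH}`, `⟨A⟩_{β,H} = tr(e^{−βH}A)/Z_β(H)`, `F_β(H) = −β⁻¹ log Z_β(H)`; the
four coupling DIRECTIONS are the unit nearest-neighbour hopping Hamiltonian `H_L(1,0,0)|_{n.n.} =
hamiltonian (fermionTorusGraph 2 L) 1 0`, the unit diagonal hopping Hamiltonian
`hamiltonian (fermionTorusDiagGraph L) 1 0`, the double occupancy `Σₓ nₓ↑nₓ↓` and `−N`.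

* `hubbardTorusTT'_eq_smul_add`, `hubbardTorusTT'_sub_mu_smul_add_smul`, `hubbardTorusTT'_sub_mu_sub` —
  `H_L(t,t',U) − μN` is linear in `(t, t', U, μ)`; `isHermitian_hubbardTorusTT'_sub_mu`.
* `convexOn_log_partitionFn_hubbardTorusTT'` (every real `β`) and **`concaveOn_freeEnergy_hubbardTorusTT'`**:
  `(t,t',U,μ) ↦ F_β(H_L(t,t',U) − μN)` is CONCAVE on `ℝ⁴` for every `β > 0` and every `L`.
* `sum_mul_le_freeEnergy_hubbardTorusTT'_sum` — JENSEN FLOORS: certified free-energy lower bounds at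
  finitely many coupling corners certify every point of their convex hull from below (no new solve).
* **`freeEnergy_hubbardTorusTT'_le_tangent`** — the FOUR-SLOPE TANGENT PLANE
  `F_β(t,s,U,μ) ≤ F_β(t₀,s₀,U₀,μ₀) + (t−t₀)⟨H_L(1,0,0)|_{n.n.}⟩₀ + (s−s₀)⟨H_L(1,0)|_{diag}⟩₀ + (U−U₀)⟨Σₓnₓ↑nₓ↓⟩₀
  − (μ−μ₀)⟨N⟩₀` (anchor Gibbs state `⟨·⟩₀`): one certified free-energy cap plus certified thermal
  expectation windows at ONE coupling cap the free energy on the whole coupling space.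
* `abs_freeEnergy_hubbardTorusTT'_sub_le` — Lipschitz continuity with the operator norms of the four
  directions as constants.
* `re_gibbsState_docc_mem_Icc_freeEnergy_slopes`, `re_gibbsState_totalNumber_mem_Icc_freeEnergy_slopes` —
  the `T > 0` GRIFFITHS BRACKETS: the thermal double occupancy (resp. particle number) at `(t,s,U,μ)` lies
  between the two one-sided free-energy difference quotients in `U` (resp. `μ`, with the sign that makes
  `F_β` decrease in `μ`): certified thermal observables in `(U, μ)` from certified free energies.

* §2 THE CANONICAL SECTOR (the torus-limit thermal convention of `TorusSectorGibbsMixture` /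
  `TorusSectorGibbsEnergyWindow`: canonical Gibbs states on the `(rectN n L, S^z = 0)` sector, filling `n`
  fixed): the compression `sectorHamiltonianTT' t t' U n L` is linear in `(t, t', U)`
  (`sectorHamiltonianTT'_eq_smul_add / _smul_add_smul / _sub`), hence
  **`concaveOn_freeEnergy_sectorHamiltonianTT'`** (the canonical free energy is jointly concave in
  `(t, t', U)` on `ℝ³`, `0 ≤ n ≤ 2`, `β > 0`), `convexOn_log_partitionFn_sectorHamiltonianTT'`,
  `sum_mul_le_freeEnergy_sectorHamiltonianTT'_sum` (Jensen corner floors — the cell floor word from the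
  free-energy certificates of the `T > 0` crew, which bind `log Z_β(sectorHamiltonianTT' …)`),
  `freeEnergy_sectorHamiltonianTT'_le_tangent` (three-slope tangent plane) and
  `re_gibbsState_docc_sector_mem_Icc_freeEnergy_slopes` (thermal docc at fixed filling from three canonical
  free energies).

HONEST SCOPE: finite torus, every `L`; transport lemmas only — no certificate, no number, no thermodynamic
limit, no phase sentence. Everything is PROVED; no definition, no named fact.

## Mathlib / tree search
REUSED: `GibbsFreeEnergyCouplingConcavity` (§1–§3), `hubbardTorusTT'`, `hubbardTorusTT'_isHermitian`
(`HubbardNNNHopping`), `hamiltonian`, `numberOp`, `totalNumber` (`HubbardWave0`), `totalNumber_isHermitian`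
(`PairFieldMomentum`), `isHermitian_real_smul` (`TraceInequalitiesProofs`), `sectorHamiltonianTT'`,
`isHermitian_sectorHamiltonianTT'`, `nonempty_szConfig` (`TorusSectorGibbsEnergyWindow`),
`Matrix.submatrix_add/_smul`. Not restated:
`hubbardTorusTT'_sub_mu_eq` (`DWaveSourceNNNHoppingOrderParameter`, the `hamiltonianWith` split — a
different decomposition), `concaveOn_groundEnergy_hubbardTorusWith` (`T = 0`, `μ` only).

## References
* E. H. Lieb, *The classical limit of quantum spin systems*, Commun. Math. Phys. 31 (1973) 327–340,
  §V eqs. (5.2)–(5.4). [cite: Lieb1973, §V (5.2)–(5.4)]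
* R. B. Israel, *Convexity in the Theory of Lattice Gases* (1979), Theorem I.3.4. [cite: Israel1979, Thm. I.3.4]
* H. Xu et al., Science 384 (2024) eadh7691, eq. (1) (the `t–t'–U` Hamiltonian). [cite: XuEtAl2024, eq. (1)]
-/

noncomputable section

open scoped Matrix.Norms.L2Operator ComplexOrder BigOperators
open Matrix Finset

namespace Literature.MathematicalPhysics.QuantumLattice

/-! ### §1 The grand-canonical torus: concavity in `(t, t', U, μ)` -/

section HubbardTorus

open HubbardWave0

variable (L : ℕ)

/-- **The `t–t'` torus Hamiltonian is linear in its couplings**: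
`H_L(t,t',U) = t·H_L(1,0,0)|_{n.n.} + t'·H_L(1,0)|_{diag} + U·Σₓ nₓ↑nₓ↓`, the three coupling DIRECTIONS
being the unit nearest-neighbour hopping Hamiltonian, the unit diagonal hopping Hamiltonian and the
double-occupancy operator. [cite: XuEtAl2024, eq. (1)] -/
theorem hubbardTorusTT'_eq_smul_add (t t' U : ℝ) :
    hubbardTorusTT' L t t' U =
      (t : ℂ) • hamiltonian (fermionTorusGraph 2 L) 1 0 +
        (t' : ℂ) • hamiltonian (fermionTorusDiagGraph L) 1 0 +
          (U : ℂ) • ∑ x : FermionTorus 2 L, numberOp x 0 * numberOp x 1 := by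
  simp only [hubbardTorusTT', hamiltonian, Complex.ofReal_one, Complex.ofReal_zero]
  module

/-- **The grand-canonical `t–t'` torus Hamiltonian `H_L(t,t',U) − μN` is an affine (indeed linear) family
in `q = (t, t', U, μ) ∈ ℝ⁴`**: `H(a q + b q') = a H(q) + b H(q')` for `a + b = 1`.
[cite: XuEtAl2024, eq. (1)] -/
theorem hubbardTorusTT'_sub_mu_smul_add_smul (x y : ℝ × ℝ × ℝ × ℝ) (a b : ℝ) (_hab : a + b = 1) :
    hubbardTorusTT' L (a • x + b • y).1 (a • x + b • y).2.1 (a • x + b • y).2.2.1 -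
        (((a • x + b • y).2.2.2 : ℝ) : ℂ) • totalNumber =
      (a : ℂ) • (hubbardTorusTT' L x.1 x.2.1 x.2.2.1 - ((x.2.2.2 : ℝ) : ℂ) • totalNumber) +
        (b : ℂ) • (hubbardTorusTT' L y.1 y.2.1 y.2.2.1 - ((y.2.2.2 : ℝ) : ℂ) • totalNumber) := by
  simp only [hubbardTorusTT'_eq_smul_add, Prod.smul_fst, Prod.smul_snd, Prod.fst_add, Prod.snd_add,
    smul_eq_mul, Complex.ofReal_add, Complex.ofReal_mul]
  module

/-- `H_L(t,t',U) − μN` is Hermitian. [cite: XuEtAl2024, eq. (1)] -/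
theorem isHermitian_hubbardTorusTT'_sub_mu (t t' U μ : ℝ) :
    (hubbardTorusTT' L t t' U - (μ : ℂ) • totalNumber).IsHermitian :=
  (hubbardTorusTT'_isHermitian L t t' U).sub (isHermitian_real_smul totalNumber_isHermitian μ)

/-- **Coupling increments**: `(H_L(t,s,U) − μN) − (H_L(t₀,s₀,U₀) − μ₀N) =
(t−t₀)·H_L(1,0,0)|_{n.n.} + (s−s₀)·H_L(1,0)|_{diag} + (U−U₀)·Σₓnₓ↑nₓ↓ − (μ−μ₀)·N`. [cite: XuEtAl2024, eq. (1)] -/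
theorem hubbardTorusTT'_sub_mu_sub (t s U μ t₀ s₀ U₀ μ₀ : ℝ) :
    (hubbardTorusTT' L t s U - (μ : ℂ) • totalNumber) - (hubbardTorusTT' L t₀ s₀ U₀ - (μ₀ : ℂ) • totalNumber) =
      ((t - t₀ : ℝ) : ℂ) • hamiltonian (fermionTorusGraph 2 L) 1 0 +
        ((s - s₀ : ℝ) : ℂ) • hamiltonian (fermionTorusDiagGraph L) 1 0 +
          ((U - U₀ : ℝ) : ℂ) • (∑ x : FermionTorus 2 L, numberOp x 0 * numberOp x 1) -
            ((μ - μ₀ : ℝ) : ℂ) • totalNumber := by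
  simp only [hubbardTorusTT'_eq_smul_add, Complex.ofReal_sub]
  module

/-- **Convexity of `(t,t',U,μ) ↦ log Z_β(H_L(t,t',U) − μN)`** on `ℝ⁴`, every real `β`, every `L`.
[cite: Israel1979, Thm. I.3.4] -/
theorem convexOn_log_partitionFn_hubbardTorusTT' (β : ℝ) :
    ConvexOn ℝ Set.univ (fun q : ℝ × ℝ × ℝ × ℝ =>
      Real.log (partitionFn β (hubbardTorusTT' L q.1 q.2.1 q.2.2.1 - ((q.2.2.2 : ℝ) : ℂ) • totalNumber)).re) :=
  convexOn_log_partitionFn_affine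
    (H := fun q : ℝ × ℝ × ℝ × ℝ => hubbardTorusTT' L q.1 q.2.1 q.2.2.1 - ((q.2.2.2 : ℝ) : ℂ) • totalNumber)
    (fun x y a b hab => hubbardTorusTT'_sub_mu_smul_add_smul L x y a b hab)
    (fun q => isHermitian_hubbardTorusTT'_sub_mu L q.1 q.2.1 q.2.2.1 q.2.2.2) β

/-- **JOINT CONCAVITY OF THE GRAND-CANONICAL FREE ENERGY IN ALL FOUR COUPLINGS `(t, t', U, μ)`**:
`q ↦ F_β(q) = −β⁻¹ log tr exp(−β(H_L(t,t',U) − μN))` is concave on `ℝ⁴` for every `β > 0` and every torus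
side `L` — the positive-temperature form of `concaveOn_gcEnergyDensityTT'_couplings`.
[cite: Israel1979, Thm. I.3.4] -/
theorem concaveOn_freeEnergy_hubbardTorusTT' {β : ℝ} (hβ : 0 < β) :
    ConcaveOn ℝ Set.univ (fun q : ℝ × ℝ × ℝ × ℝ =>
      -(β⁻¹ * Real.log (partitionFn β
        (hubbardTorusTT' L q.1 q.2.1 q.2.2.1 - ((q.2.2.2 : ℝ) : ℂ) • totalNumber)).re)) :=
  concaveOn_freeEnergy_affine
    (H := fun q : ℝ × ℝ × ℝ × ℝ => hubbardTorusTT' L q.1 q.2.1 q.2.2.1 - ((q.2.2.2 : ℝ) : ℂ) • totalNumber)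
    (fun x y a b hab => hubbardTorusTT'_sub_mu_smul_add_smul L x y a b hab)
    (fun q => isHermitian_hubbardTorusTT'_sub_mu L q.1 q.2.1 q.2.2.1 q.2.2.2) hβ

/-- **Jensen floors on the torus**: certified free-energy lower bounds `ℓₖ ≤ F_β(qₖ)` at finitely many
coupling corners `qₖ = (tₖ, t'ₖ, Uₖ, μₖ)` and convex weights give `Σ wₖ ℓₖ ≤ F_β(Σ wₖ qₖ)` (`β > 0`).
[cite: Israel1979, Thm. I.3.4] -/
theorem sum_mul_le_freeEnergy_hubbardTorusTT'_sum {β : ℝ} (hβ : 0 < β) {κ : Type*} (s : Finset κ)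
    (w : κ → ℝ) (q : κ → ℝ × ℝ × ℝ × ℝ) (ℓ : κ → ℝ) (hw : ∀ k ∈ s, 0 ≤ w k) (hw1 : ∑ k ∈ s, w k = 1)
    (hℓ : ∀ k ∈ s, ℓ k ≤ -(β⁻¹ * Real.log (partitionFn β
      (hubbardTorusTT' L (q k).1 (q k).2.1 (q k).2.2.1 - (((q k).2.2.2 : ℝ) : ℂ) • totalNumber)).re)) :
    ∑ k ∈ s, w k * ℓ k ≤ -(β⁻¹ * Real.log (partitionFn β
      (hubbardTorusTT' L (∑ k ∈ s, w k • q k).1 (∑ k ∈ s, w k • q k).2.1 (∑ k ∈ s, w k • q k).2.2.1 -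
        (((∑ k ∈ s, w k • q k).2.2.2 : ℝ) : ℂ) • totalNumber)).re) :=
  sum_mul_le_freeEnergy_affine_sum
    (H := fun q : ℝ × ℝ × ℝ × ℝ => hubbardTorusTT' L q.1 q.2.1 q.2.2.1 - ((q.2.2.2 : ℝ) : ℂ) • totalNumber)
    (fun x y a b hab => hubbardTorusTT'_sub_mu_smul_add_smul L x y a b hab)
    (fun q => isHermitian_hubbardTorusTT'_sub_mu L q.1 q.2.1 q.2.2.1 q.2.2.2) hβ s w q ℓ hw hw1 hℓ

/-- **THE FOUR-SLOPE TANGENT PLANE (`T > 0` tangent-plane lemma)**: for `β > 0`, an anchor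
`(t₀, s₀, U₀, μ₀)` and ANY target `(t, s, U, μ)`,
`F_β(t,s,U,μ) ≤ F_β(t₀,s₀,U₀,μ₀) + (t−t₀)⟨H_L(1,0,0)|_{n.n.}⟩₀ + (s−s₀)⟨H_L(1,0)|_{diag}⟩₀ + (U−U₀)⟨Σₓnₓ↑nₓ↓⟩₀
 − (μ−μ₀)⟨N⟩₀`, the slopes being the thermal hopping energies, double occupancy and particle number in the
ANCHOR's grand-canonical Gibbs state `⟨·⟩₀`: a certified free-energy cap and certified thermal expectation
windows at one coupling cap the free energy on the whole `(t, t', U, μ)` space. [cite: Lieb1973, §V (5.2)–(5.4)] -/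
theorem freeEnergy_hubbardTorusTT'_le_tangent {β : ℝ} (hβ : 0 < β) (t s U μ t₀ s₀ U₀ μ₀ : ℝ) :
    -(β⁻¹ * Real.log (partitionFn β (hubbardTorusTT' L t s U - (μ : ℂ) • totalNumber)).re) ≤
      -(β⁻¹ * Real.log (partitionFn β (hubbardTorusTT' L t₀ s₀ U₀ - (μ₀ : ℂ) • totalNumber)).re) +
        ((t - t₀) * (gibbsState β (hubbardTorusTT' L t₀ s₀ U₀ - (μ₀ : ℂ) • totalNumber)
            (hamiltonian (fermionTorusGraph 2 L) 1 0)).re +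
          (s - s₀) * (gibbsState β (hubbardTorusTT' L t₀ s₀ U₀ - (μ₀ : ℂ) • totalNumber)
            (hamiltonian (fermionTorusDiagGraph L) 1 0)).re +
          (U - U₀) * (gibbsState β (hubbardTorusTT' L t₀ s₀ U₀ - (μ₀ : ℂ) • totalNumber)
            (∑ x : FermionTorus 2 L, numberOp x 0 * numberOp x 1)).re -
          (μ - μ₀) * (gibbsState β (hubbardTorusTT' L t₀ s₀ U₀ - (μ₀ : ℂ) • totalNumber)
            totalNumber).re) := by
  have h := freeEnergy_affine_le_tangent
    (H := fun q : ℝ × ℝ × ℝ × ℝ => hubbardTorusTT' L q.1 q.2.1 q.2.2.1 - ((q.2.2.2 : ℝ) : ℂ) • totalNumber)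
    (fun q => isHermitian_hubbardTorusTT'_sub_mu L q.1 q.2.1 q.2.2.1 q.2.2.2) hβ (t₀, s₀, U₀, μ₀) (t, s, U, μ)
  simp only at h
  rw [hubbardTorusTT'_sub_mu_sub, map_sub, map_add, map_add, map_smul, map_smul, map_smul, map_smul,
    smul_eq_mul, smul_eq_mul, smul_eq_mul, smul_eq_mul, Complex.sub_re, Complex.add_re, Complex.add_re,
    Complex.re_ofReal_mul, Complex.re_ofReal_mul, Complex.re_ofReal_mul, Complex.re_ofReal_mul] at h
  exact h

/-- **Lipschitz continuity of the torus free energy in the couplings** (`β > 0`):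
`|F_β(t,s,U,μ) − F_β(t₀,s₀,U₀,μ₀)| ≤ |t−t₀|‖H_L(1,0,0)|_{n.n.}‖ + |s−s₀|‖H_L(1,0)|_{diag}‖ + |U−U₀|‖Σₓnₓ↑nₓ↓‖
 + |μ−μ₀|‖N‖` (operator norms). [cite: Israel1979, Thm. I.3.4] -/
theorem abs_freeEnergy_hubbardTorusTT'_sub_le {β : ℝ} (hβ : 0 < β) (t s U μ t₀ s₀ U₀ μ₀ : ℝ) :
    |-(β⁻¹ * Real.log (partitionFn β (hubbardTorusTT' L t s U - (μ : ℂ) • totalNumber)).re) -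
        -(β⁻¹ * Real.log (partitionFn β (hubbardTorusTT' L t₀ s₀ U₀ - (μ₀ : ℂ) • totalNumber)).re)| ≤
      |t - t₀| * ‖hamiltonian (fermionTorusGraph 2 L) 1 0‖ +
        |s - s₀| * ‖hamiltonian (fermionTorusDiagGraph L) 1 0‖ +
          |U - U₀| * ‖∑ x : FermionTorus 2 L, numberOp x 0 * numberOp x 1‖ +
            |μ - μ₀| * ‖(totalNumber : Matrix (Finset (Orb (FermionTorus 2 L))) _ ℂ)‖ := by
  have h := abs_freeEnergy_affine_sub_le
    (H := fun q : ℝ × ℝ × ℝ × ℝ => hubbardTorusTT' L q.1 q.2.1 q.2.2.1 - ((q.2.2.2 : ℝ) : ℂ) • totalNumber)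
    (fun q => isHermitian_hubbardTorusTT'_sub_mu L q.1 q.2.1 q.2.2.1 q.2.2.2) hβ (t, s, U, μ) (t₀, s₀, U₀, μ₀)
  simp only at h
  rw [hubbardTorusTT'_sub_mu_sub] at h
  refine h.trans ?_
  have hn : ∀ (r : ℝ) (M : Matrix (Finset (Orb (FermionTorus 2 L))) (Finset (Orb (FermionTorus 2 L))) ℂ),
      ‖((r : ℝ) : ℂ) • M‖ = |r| * ‖M‖ := fun r M => by
    rw [norm_smul, Complex.norm_real, Real.norm_eq_abs]
  calc _ ≤ ‖((t - t₀ : ℝ) : ℂ) • hamiltonian (fermionTorusGraph 2 L) 1 0 +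
        ((s - s₀ : ℝ) : ℂ) • hamiltonian (fermionTorusDiagGraph L) 1 0 +
          ((U - U₀ : ℝ) : ℂ) • (∑ x : FermionTorus 2 L, numberOp x 0 * numberOp x 1)‖ +
            ‖((μ - μ₀ : ℝ) : ℂ) • (totalNumber : Matrix (Finset (Orb (FermionTorus 2 L))) _ ℂ)‖ :=
          norm_sub_le _ _
    _ ≤ ‖((t - t₀ : ℝ) : ℂ) • hamiltonian (fermionTorusGraph 2 L) 1 0‖ +
        ‖((s - s₀ : ℝ) : ℂ) • hamiltonian (fermionTorusDiagGraph L) 1 0‖ +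
          ‖((U - U₀ : ℝ) : ℂ) • (∑ x : FermionTorus 2 L, numberOp x 0 * numberOp x 1)‖ +
            ‖((μ - μ₀ : ℝ) : ℂ) • (totalNumber : Matrix (Finset (Orb (FermionTorus 2 L))) _ ℂ)‖ :=
          add_le_add norm_add₃_le le_rfl
    _ = _ := by rw [hn, hn, hn, hn]

/-- **Thermal double occupancy from free energies at `U ± h` (`T > 0` Griffiths bracket in `U`)**: for
`β > 0`, `h > 0`, `(F_β(U+h) − F_β(U))/h ≤ Re⟨Σₓ nₓ↑nₓ↓⟩_{β,(t,s,U,μ)} ≤ (F_β(U) − F_β(U−h))/h`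
(other couplings fixed). [cite: Lieb1973, §V (5.2)–(5.4)] -/
theorem re_gibbsState_docc_mem_Icc_freeEnergy_slopes {β : ℝ} (hβ : 0 < β) (t s U μ : ℝ) {h : ℝ}
    (hh : 0 < h) :
    (gibbsState β (hubbardTorusTT' L t s U - (μ : ℂ) • totalNumber)
        (∑ x : FermionTorus 2 L, numberOp x 0 * numberOp x 1)).re ∈
      Set.Icc
        ((-(β⁻¹ * Real.log (partitionFn β (hubbardTorusTT' L t s (U + h) - (μ : ℂ) • totalNumber)).re) -
            -(β⁻¹ * Real.log (partitionFn β (hubbardTorusTT' L t s U - (μ : ℂ) • totalNumber)).re)) / h)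
        ((-(β⁻¹ * Real.log (partitionFn β (hubbardTorusTT' L t s U - (μ : ℂ) • totalNumber)).re) -
            -(β⁻¹ * Real.log (partitionFn β (hubbardTorusTT' L t s (U - h) - (μ : ℂ) • totalNumber)).re)) / h) := by
  set Dc : Matrix (Finset (Orb (FermionTorus 2 L))) (Finset (Orb (FermionTorus 2 L))) ℂ :=
    ∑ x : FermionTorus 2 L, numberOp x 0 * numberOp x 1 with hDc
  have hDch : Dc.IsHermitian := by
    have h1 := hubbardTorusTT'_isHermitian L 0 0 1
    rw [hubbardTorusTT'_eq_smul_add, Complex.ofReal_zero, zero_smul, zero_smul, zero_add, zero_add,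
      Complex.ofReal_one, one_smul] at h1
    exact h1
  have hplus : hubbardTorusTT' L t s (U + h) - (μ : ℂ) • totalNumber =
      (hubbardTorusTT' L t s U - (μ : ℂ) • totalNumber) + (h : ℂ) • Dc := by
    rw [← sub_eq_iff_eq_add', hubbardTorusTT'_sub_mu_sub]
    simp only [sub_self, Complex.ofReal_zero, zero_smul, zero_add, add_zero, sub_zero, add_sub_cancel_left, hDc]
  have hminus : hubbardTorusTT' L t s U - (μ : ℂ) • totalNumber =
      (hubbardTorusTT' L t s (U - h) - (μ : ℂ) • totalNumber) + (h : ℂ) • Dc := by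
    rw [← sub_eq_iff_eq_add', hubbardTorusTT'_sub_mu_sub]
    simp only [sub_self, Complex.ofReal_zero, zero_smul, zero_add, add_zero, sub_zero, sub_sub_cancel, hDc]
  have hW : ((h : ℂ) • Dc).IsHermitian := isHermitian_real_smul hDch h
  constructor
  · have h1 := (freeEnergy_sub_mem_Icc (isHermitian_hubbardTorusTT'_sub_mu L t s U μ) hW hβ).2
    rw [← hplus, map_smul, smul_eq_mul, Complex.re_ofReal_mul] at h1
    rw [div_le_iff₀ hh]
    linarith
  · have h1 := (freeEnergy_sub_mem_Icc (isHermitian_hubbardTorusTT'_sub_mu L t s (U - h) μ) hW hβ).1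
    rw [← hminus, map_smul, smul_eq_mul, Complex.re_ofReal_mul] at h1
    rw [le_div_iff₀ hh]
    linarith

/-- **Thermal particle number from free energies at `μ ± h` (`T > 0` Griffiths bracket in `μ`)**: for
`β > 0`, `h > 0`, `(F_β(μ−h) − F_β(μ))/h ≤ Re⟨N⟩_{β,(t,s,U,μ)} ≤ (F_β(μ) − F_β(μ+h))/h` — the density
coordinate enters with a minus sign, so the free energy DEcreases in `μ` at rate `⟨N⟩`.
[cite: Lieb1973, §V (5.2)–(5.4)] -/
theorem re_gibbsState_totalNumber_mem_Icc_freeEnergy_slopes {β : ℝ} (hβ : 0 < β) (t s U μ : ℝ) {h : ℝ}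
    (hh : 0 < h) :
    (gibbsState β (hubbardTorusTT' L t s U - (μ : ℂ) • totalNumber) totalNumber).re ∈
      Set.Icc
        ((-(β⁻¹ * Real.log (partitionFn β (hubbardTorusTT' L t s U - ((μ - h : ℝ) : ℂ) • totalNumber)).re) -
            -(β⁻¹ * Real.log (partitionFn β (hubbardTorusTT' L t s U - (μ : ℂ) • totalNumber)).re)) / h)
        ((-(β⁻¹ * Real.log (partitionFn β (hubbardTorusTT' L t s U - (μ : ℂ) • totalNumber)).re) -
            -(β⁻¹ * Real.log (partitionFn β (hubbardTorusTT' L t s U - ((μ + h : ℝ) : ℂ) • totalNumber)).re)) / h) := by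
  set N : Matrix (Finset (Orb (FermionTorus 2 L))) (Finset (Orb (FermionTorus 2 L))) ℂ := totalNumber
    with hN
  have hminus : hubbardTorusTT' L t s U - ((μ - h : ℝ) : ℂ) • N =
      (hubbardTorusTT' L t s U - (μ : ℂ) • N) + (h : ℂ) • N := by
    rw [Complex.ofReal_sub, sub_smul]; abel
  have hplus : hubbardTorusTT' L t s U - (μ : ℂ) • N =
      (hubbardTorusTT' L t s U - ((μ + h : ℝ) : ℂ) • N) + (h : ℂ) • N := by
    rw [Complex.ofReal_add, add_smul]; abel
  have hW : ((h : ℂ) • N).IsHermitian := isHermitian_real_smul totalNumber_isHermitian h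
  constructor
  · have h1 := (freeEnergy_sub_mem_Icc (isHermitian_hubbardTorusTT'_sub_mu L t s U μ) hW hβ).2
    rw [← hminus, map_smul, smul_eq_mul, Complex.re_ofReal_mul] at h1
    rw [div_le_iff₀ hh]
    linarith
  · have h1 := (freeEnergy_sub_mem_Icc (isHermitian_hubbardTorusTT'_sub_mu L t s U (μ + h)) hW hβ).1
    rw [← hplus, map_smul, smul_eq_mul, Complex.re_ofReal_mul] at h1
    rw [le_div_iff₀ hh]
    linarith

end HubbardTorus

/-! ### §2 The canonical sector: concavity in `(t, t', U)` at fixed filling -/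

section Sector

open HubbardWave0

/-- **The canonical-sector Hamiltonian is linear in `(t, t', U)`**: the compression
`H_L(t,t',U)|_{(rectN n L, S^z = 0)} = sectorHamiltonianTT' t t' U n L` of `TorusSectorGibbsEnergyWindow` is
`t·K₁|_s + t'·K₂|_s + U·D|_s` with the compressed unit hopping Hamiltonians and double occupancy.
[cite: XuEtAl2024, eq. (1)] -/
theorem sectorHamiltonianTT'_eq_smul_add (t t' U n : ℝ) (L : ℕ) :
    sectorHamiltonianTT' t t' U n L =
      (t : ℂ) • (hamiltonian (fermionTorusGraph 2 L) 1 0).submatrix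
          (Subtype.val : Subtype (szConfig n L) → _) Subtype.val +
        (t' : ℂ) • (hamiltonian (fermionTorusDiagGraph L) 1 0).submatrix
          (Subtype.val : Subtype (szConfig n L) → _) Subtype.val +
          (U : ℂ) • (∑ x : FermionTorus 2 L, numberOp x 0 * numberOp x 1).submatrix
            (Subtype.val : Subtype (szConfig n L) → _) Subtype.val := by
  rw [sectorHamiltonianTT', hubbardTorusTT'_eq_smul_add, submatrix_add, submatrix_add, submatrix_smul,
    submatrix_smul, submatrix_smul]
  rfl

/-- The sector Hamiltonian is an affine (indeed linear) family in `q = (t, t', U) ∈ ℝ³`.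
[cite: XuEtAl2024, eq. (1)] -/
theorem sectorHamiltonianTT'_smul_add_smul (n : ℝ) (L : ℕ) (x y : ℝ × ℝ × ℝ) (a b : ℝ)
    (_hab : a + b = 1) :
    sectorHamiltonianTT' (a • x + b • y).1 (a • x + b • y).2.1 (a • x + b • y).2.2 n L =
      (a : ℂ) • sectorHamiltonianTT' x.1 x.2.1 x.2.2 n L +
        (b : ℂ) • sectorHamiltonianTT' y.1 y.2.1 y.2.2 n L := by
  simp only [sectorHamiltonianTT'_eq_smul_add, Prod.smul_fst, Prod.smul_snd, Prod.fst_add, Prod.snd_add,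
    smul_eq_mul, Complex.ofReal_add, Complex.ofReal_mul]
  module

/-- Coupling increments of the sector Hamiltonian. [cite: XuEtAl2024, eq. (1)] -/
theorem sectorHamiltonianTT'_sub (t s U t₀ s₀ U₀ n : ℝ) (L : ℕ) :
    sectorHamiltonianTT' t s U n L - sectorHamiltonianTT' t₀ s₀ U₀ n L =
      ((t - t₀ : ℝ) : ℂ) • (hamiltonian (fermionTorusGraph 2 L) 1 0).submatrix
          (Subtype.val : Subtype (szConfig n L) → _) Subtype.val +
        ((s - s₀ : ℝ) : ℂ) • (hamiltonian (fermionTorusDiagGraph L) 1 0).submatrix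
          (Subtype.val : Subtype (szConfig n L) → _) Subtype.val +
          ((U - U₀ : ℝ) : ℂ) • (∑ x : FermionTorus 2 L, numberOp x 0 * numberOp x 1).submatrix
            (Subtype.val : Subtype (szConfig n L) → _) Subtype.val := by
  simp only [sectorHamiltonianTT'_eq_smul_add, Complex.ofReal_sub]
  module

/-- The compressed double occupancy is Hermitian. [folklore] -/
private theorem isHermitian_docc_submatrix (n : ℝ) (L : ℕ) :
    ((∑ x : FermionTorus 2 L, numberOp x 0 * numberOp x 1).submatrix
      (Subtype.val : Subtype (szConfig n L) → _) Subtype.val).IsHermitian := by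
  have h1 := hubbardTorusTT'_isHermitian L 0 0 1
  rw [hubbardTorusTT'_eq_smul_add, Complex.ofReal_zero, zero_smul, zero_smul, zero_add, zero_add,
    Complex.ofReal_one, one_smul] at h1
  exact h1.submatrix Subtype.val

/-- **Convexity of `(t,t',U) ↦ log Z_β(H_L(t,t',U)|_{sector})`** — the canonical `log`-partition function of
the `(rectN n L, S^z = 0)` sector is jointly convex in the couplings (`0 ≤ n ≤ 2`, every real `β`).
[cite: Israel1979, Thm. I.3.4] -/
theorem convexOn_log_partitionFn_sectorHamiltonianTT' {n : ℝ} (hn0 : 0 ≤ n) (hn2 : n ≤ 2) (L : ℕ) (β : ℝ) :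
    ConvexOn ℝ Set.univ (fun q : ℝ × ℝ × ℝ =>
      Real.log (partitionFn β (sectorHamiltonianTT' q.1 q.2.1 q.2.2 n L)).re) := by
  haveI := nonempty_szConfig hn0 hn2 L
  exact convexOn_log_partitionFn_affine
    (H := fun q : ℝ × ℝ × ℝ => sectorHamiltonianTT' q.1 q.2.1 q.2.2 n L)
    (fun x y a b hab => sectorHamiltonianTT'_smul_add_smul n L x y a b hab)
    (fun q => isHermitian_sectorHamiltonianTT' q.1 q.2.1 q.2.2 n L) β

/-- **JOINT CONCAVITY OF THE CANONICAL FREE ENERGY IN `(t, t', U)`** at fixed filling: for `0 ≤ n ≤ 2`,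
`β > 0` and every `L`, `(t,t',U) ↦ −β⁻¹ log Z_β(H_L(t,t',U)|_{(rectN n L, S^z=0)})` is concave on `ℝ³` — the
positive-temperature form of `concaveOn_energyDensityTT'_couplings` (before the thermodynamic limit).
[cite: Israel1979, Thm. I.3.4] -/
theorem concaveOn_freeEnergy_sectorHamiltonianTT' {n : ℝ} (hn0 : 0 ≤ n) (hn2 : n ≤ 2) (L : ℕ) {β : ℝ}
    (hβ : 0 < β) :
    ConcaveOn ℝ Set.univ (fun q : ℝ × ℝ × ℝ =>
      -(β⁻¹ * Real.log (partitionFn β (sectorHamiltonianTT' q.1 q.2.1 q.2.2 n L)).re)) := by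
  haveI := nonempty_szConfig hn0 hn2 L
  exact concaveOn_freeEnergy_affine
    (H := fun q : ℝ × ℝ × ℝ => sectorHamiltonianTT' q.1 q.2.1 q.2.2 n L)
    (fun x y a b hab => sectorHamiltonianTT'_smul_add_smul n L x y a b hab)
    (fun q => isHermitian_sectorHamiltonianTT' q.1 q.2.1 q.2.2 n L) hβ

/-- **Jensen floors for the canonical free energy**: certified lower bounds `ℓₖ ≤ F_β(H_L(qₖ)|_s)` at coupling
corners `qₖ = (tₖ, t'ₖ, Uₖ)` and convex weights give `Σ wₖ ℓₖ ≤ F_β(H_L(Σ wₖ qₖ)|_s)` — with thermal-p2's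
per-volume normalisation (`ℓ·L² ≤ log Z`) this is the cell FLOOR word from corner certificates.
[cite: Israel1979, Thm. I.3.4] -/
theorem sum_mul_le_freeEnergy_sectorHamiltonianTT'_sum {n : ℝ} (hn0 : 0 ≤ n) (hn2 : n ≤ 2) (L : ℕ)
    {β : ℝ} (hβ : 0 < β) {κ : Type*} (S : Finset κ) (w : κ → ℝ) (q : κ → ℝ × ℝ × ℝ) (ℓ : κ → ℝ)
    (hw : ∀ k ∈ S, 0 ≤ w k) (hw1 : ∑ k ∈ S, w k = 1)
    (hℓ : ∀ k ∈ S, ℓ k ≤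
      -(β⁻¹ * Real.log (partitionFn β (sectorHamiltonianTT' (q k).1 (q k).2.1 (q k).2.2 n L)).re)) :
    ∑ k ∈ S, w k * ℓ k ≤ -(β⁻¹ * Real.log (partitionFn β (sectorHamiltonianTT'
      (∑ k ∈ S, w k • q k).1 (∑ k ∈ S, w k • q k).2.1 (∑ k ∈ S, w k • q k).2.2 n L)).re) := by
  haveI := nonempty_szConfig hn0 hn2 L
  exact sum_mul_le_freeEnergy_affine_sum
    (H := fun q : ℝ × ℝ × ℝ => sectorHamiltonianTT' q.1 q.2.1 q.2.2 n L)
    (fun x y a b hab => sectorHamiltonianTT'_smul_add_smul n L x y a b hab)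
    (fun q => isHermitian_sectorHamiltonianTT' q.1 q.2.1 q.2.2 n L) hβ S w q ℓ hw hw1 hℓ

/-- **The three-slope tangent plane of the canonical free energy** (`0 ≤ n ≤ 2`, `β > 0`):
`F_β(t,s,U) ≤ F_β(t₀,s₀,U₀) + (t−t₀)⟨K₁|_s⟩₀ + (s−s₀)⟨K₂|_s⟩₀ + (U−U₀)⟨D|_s⟩₀`, slopes = expectations of the
compressed unit hopping Hamiltonians and double occupancy in the ANCHOR's canonical Gibbs state.
[cite: Lieb1973, §V (5.2)–(5.4)] -/
theorem freeEnergy_sectorHamiltonianTT'_le_tangent {n : ℝ} (hn0 : 0 ≤ n) (hn2 : n ≤ 2) (L : ℕ) {β : ℝ}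
    (hβ : 0 < β) (t s U t₀ s₀ U₀ : ℝ) :
    -(β⁻¹ * Real.log (partitionFn β (sectorHamiltonianTT' t s U n L)).re) ≤
      -(β⁻¹ * Real.log (partitionFn β (sectorHamiltonianTT' t₀ s₀ U₀ n L)).re) +
        ((t - t₀) * (gibbsState β (sectorHamiltonianTT' t₀ s₀ U₀ n L)
            ((hamiltonian (fermionTorusGraph 2 L) 1 0).submatrix
              (Subtype.val : Subtype (szConfig n L) → _) Subtype.val)).re +
          (s - s₀) * (gibbsState β (sectorHamiltonianTT' t₀ s₀ U₀ n L)
            ((hamiltonian (fermionTorusDiagGraph L) 1 0).submatrix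
              (Subtype.val : Subtype (szConfig n L) → _) Subtype.val)).re +
          (U - U₀) * (gibbsState β (sectorHamiltonianTT' t₀ s₀ U₀ n L)
            ((∑ x : FermionTorus 2 L, numberOp x 0 * numberOp x 1).submatrix
              (Subtype.val : Subtype (szConfig n L) → _) Subtype.val)).re) := by
  haveI := nonempty_szConfig hn0 hn2 L
  have h := freeEnergy_affine_le_tangent
    (H := fun q : ℝ × ℝ × ℝ => sectorHamiltonianTT' q.1 q.2.1 q.2.2 n L)
    (fun q => isHermitian_sectorHamiltonianTT' q.1 q.2.1 q.2.2 n L) hβ (t₀, s₀, U₀) (t, s, U)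
  simp only at h
  rw [sectorHamiltonianTT'_sub, map_add, map_add, map_smul, map_smul, map_smul, smul_eq_mul, smul_eq_mul,
    smul_eq_mul, Complex.add_re, Complex.add_re, Complex.re_ofReal_mul, Complex.re_ofReal_mul,
    Complex.re_ofReal_mul] at h
  exact h

/-- **Thermal double occupancy in the canonical sector from free energies at `U ± h`** (`0 ≤ n ≤ 2`,
`β > 0`, `h > 0`): `(F_β(U+h) − F_β(U))/h ≤ Re⟨D|_s⟩_{β,(t,s,U)} ≤ (F_β(U) − F_β(U−h))/h` — a certified
thermal docc window at fixed filling from three certified canonical free energies.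
[cite: Lieb1973, §V (5.2)–(5.4)] -/
theorem re_gibbsState_docc_sector_mem_Icc_freeEnergy_slopes {n : ℝ} (hn0 : 0 ≤ n) (hn2 : n ≤ 2) (L : ℕ)
    {β : ℝ} (hβ : 0 < β) (t s U : ℝ) {h : ℝ} (hh : 0 < h) :
    (gibbsState β (sectorHamiltonianTT' t s U n L)
        ((∑ x : FermionTorus 2 L, numberOp x 0 * numberOp x 1).submatrix
          (Subtype.val : Subtype (szConfig n L) → _) Subtype.val)).re ∈
      Set.Icc
        ((-(β⁻¹ * Real.log (partitionFn β (sectorHamiltonianTT' t s (U + h) n L)).re) -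
            -(β⁻¹ * Real.log (partitionFn β (sectorHamiltonianTT' t s U n L)).re)) / h)
        ((-(β⁻¹ * Real.log (partitionFn β (sectorHamiltonianTT' t s U n L)).re) -
            -(β⁻¹ * Real.log (partitionFn β (sectorHamiltonianTT' t s (U - h) n L)).re)) / h) := by
  haveI := nonempty_szConfig hn0 hn2 L
  set Dc := (∑ x : FermionTorus 2 L, numberOp x 0 * numberOp x 1).submatrix
    (Subtype.val : Subtype (szConfig n L) → _) Subtype.val with hDc
  have hplus : sectorHamiltonianTT' t s (U + h) n L = sectorHamiltonianTT' t s U n L + (h : ℂ) • Dc := by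
    rw [← sub_eq_iff_eq_add', sectorHamiltonianTT'_sub]
    simp only [sub_self, Complex.ofReal_zero, zero_smul, zero_add, add_sub_cancel_left, hDc]
  have hminus : sectorHamiltonianTT' t s U n L = sectorHamiltonianTT' t s (U - h) n L + (h : ℂ) • Dc := by
    rw [← sub_eq_iff_eq_add', sectorHamiltonianTT'_sub]
    simp only [sub_self, Complex.ofReal_zero, zero_smul, zero_add, sub_sub_cancel, hDc]
  have hW : ((h : ℂ) • Dc).IsHermitian := isHermitian_real_smul (isHermitian_docc_submatrix n L) h
  constructor
  · have h1 := (freeEnergy_sub_mem_Icc (isHermitian_sectorHamiltonianTT' t s U n L) hW hβ).2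
    rw [← hplus, map_smul, smul_eq_mul, Complex.re_ofReal_mul] at h1
    rw [div_le_iff₀ hh]
    linarith
  · have h1 := (freeEnergy_sub_mem_Icc (isHermitian_sectorHamiltonianTT' t s (U - h) n L) hW hβ).1
    rw [← hminus, map_smul, smul_eq_mul, Complex.re_ofReal_mul] at h1
    rw [le_div_iff₀ hh]
    linarith

end Sector

end Literature.MathematicalPhysics.QuantumLattice
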